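import Literature.AlgebraicGeometry.ShimuraVarieties.UnitaryBallHolomorphicTranslate
import Literature.AlgebraicGeometry.ShimuraVarieties.UnitaryBallLiftPairingBall
import Literature.Geometry.ComplexHyperbolic.UnitBallBounds
import Mathlib.Analysis.Calculus.SmoothSeries
import Mathlib.Analysis.Normed.Group.Tannery
import Mathlib.Analysis.SpecificLimits.Normed
import HarnessLib

/-!
# Poincaré series on the ball `𝔹²` separate tangent vectors

Let `ρ : Γ → U(2,1)` act on the unit ball `𝔹² ⊂ ℂ²` (the tree's `BallModel.Ball`, action `g • z`,
Jacobian cocycle `BallModel.Jac`, canonical automorphy factor `J(g, z) = det D(g)(z) =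
BallForms.canonicalFactor g z`). For a bounded function `φ` on the ball and a weight `k` the Poincaré
series is `P φ (z) = ∑_γ J(ρ γ, z)ᵏ φ(ρ γ z)` (`UnitaryBallPoincareSeries.lean` proves its absolute and
locally uniform convergence for `k ≥ 2` from the convergence of the lattice sums `∑_γ ‖(ρ γ)₂₂‖⁻ⁿ`,
`n ≥ 6`, which holds for every discrete `ρ(Γ)`). We PROVE the second half of Shafarevich's Lemma of
*Basic Algebraic Geometry 2*, Ch. IX §3.2 (condition (B): "for any point `z₀ ∈ D` there exist automorphic
forms `f₀` and `f₁`" with `f₀(z₀) f₁'(z₀) - f₁(z₀) f₀'(z₀) ≠ 0`, held text p. 270), in dimension `2` and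
in the quantitative form needed for a projective embedding:

* `exists_poincareSeries_immersion` — **Poincaré series separate tangent vectors**: if the lattice sums
  `∑_γ ‖(ρ γ)₂₂‖⁻ⁿ` (`n ≥ 6`) converge and `ρ(Γ)` acts freely at `z₀`, there are three bounded holomorphic
  test functions `φ₀, φ₁, φ₂` (restrictions of polynomials, with bounded derivative) such that FOR ALL
  LARGE WEIGHTS `k` the Poincaré series `fᵢ = P φᵢ` have: `f₀(z₀) ≠ 0`, the zero extension `f̃ᵢ` is
  complex differentiable at `z₀` with derivative `Lᵢ`, and `det (fᵢ(z₀), Lᵢ e₀, Lᵢ e₁)ᵢ ≠ 0` — i.e.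
  `z ↦ (f₁/f₀, f₂/f₀)(z)` has invertible differential at `z₀` and `[f₀ : f₁ : f₂]` is an immersion at
  `z₀`; `exists_poincareSeries_immersion_subgroup` is the same for a subgroup `Δ ≤ U(2,1)` with
  `IsCancelSMul Δ Ball` (free action);
* `hasFDerivAt_extend_poincareSeries` — **termwise differentiation**: for `k ≥ 2` and holomorphic `φ`
  with `|φ| ≤ B`, `‖Dφ̃‖ ≤ B'` on the ball, `P̃ φ` is differentiable at every point of the ball with
  derivative the sum of the derivatives of the terms (Weierstrass M-test for the differentiated series
  on a neighbourhood, majorant `∝ ‖(ρ γ)₂₂‖^{-3k}`; `hasFDerivAt_term`, `norm_termDeriv_le`);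
* `tendsto_poincareSeries_apply`, `tendsto_poincareSeriesDeriv` — **the limit `k → ∞`**: if `φ`
  vanishes to second order at the exceptional orbit points `ρ γ z₀` (`γ ≠ 1`, `|J(ρ γ, z₀)| ≥ 1/2`,
  a finite set: `finite_setOf_half_le_norm_canonicalFactor`), then `P φ (z₀) → φ(z₀)` and
  `D(P̃ φ)(z₀) → Dφ̃(z₀)` (Tannery's theorem; the identity term is `φ` itself since `J(1, ·) = 1`);
* `exists_testFunctions` — polynomial test functions with prescribed one-jet at `z₀` vanishing to second
  order on a finite set (products of squares of affine forms), and the elementary estimates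
  `norm_Jac_apply_le`, `norm_JacCLM_le`, `inv_norm_W3_le` (`‖D(g)(z)‖ ≤ 4 (1 - |z|)⁻¹`,
  `|(g·(z,1))₂|⁻¹ ≤ (1 - |z|)⁻¹ ‖g₂₂‖⁻¹`).

## The proof (Shafarevich, loc. cit., with `𝔹²` for the disc)

Write `f = P φ = φ + ∑_{γ ∈ E ∖ 1} J_γᵏ φ∘γ + ∑_{γ ∉ E} J_γᵏ φ∘γ` with the finite exceptional set
`E = {|J_γ(z₀)| ≥ 1/2}`. If `φ` and `Dφ̃` vanish at the points `ρ γ z₀`, `γ ∈ E ∖ 1` (distinct from `z₀`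
by freeness), the middle sum and its derivative vanish at `z₀`; the last sum is `O(2⁻ᵏ)` together with
its derivative (`k |J|^{k-1} ≤ 3 |J|²` for `|J| ≤ 1/2`, `k ≥ 3`, and the derivative of one term is
bounded by `6 A⁴ B k|J|^{k-1} + 4 A B' |J|ᵏ`, `A = (1 - |z₀|)⁻¹`). Hence the one-jet of `fᵢ` at `z₀`
tends to that of `φᵢ`; choosing `φ₀(z₀) = 1`, `φⱼ(z₀) = 0`, `Dφ̃ⱼ(z₀) = dz_{j-1}` makes the limit matrix
unipotent, so the determinant tends to `1`.

The only input beyond Mathlib and the tree's ball files is the convergence of the lattice sums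
`∑_γ ‖(ρ γ)₂₂‖⁻ⁿ` (`n ≥ 6`), taken as the hypothesis `hS`; it is
`BallPoincare.summable_inv_norm_22_pow ρ hρ` of `UnitaryBallPoincareSeries.lean` for every `ρ` with
`{γ | ‖(ρ γ)₂₂‖ ≤ R}` finite for all `R` (in particular for every properly discontinuous subgroup of
`U(2,1)` — the corner-entry finiteness of such subgroups is the companion bridge file of the same
programme), so that file is deliberately not imported here (two of its one-line estimates are reproved
privately).

References: I. R. Shafarevich, *Basic Algebraic Geometry 2* (Springer 1994), Book 3, Ch. IX §3.2, Theorem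
and Lemma (held: `book:shafarevich1994-basic-algebraic-geometry-2-schemes-amd-complex`, p. 270), with
the Remark after the Theorem ("the proof carries over almost without change to the case when `D` is any
bounded domain in `ℂⁿ`"); J. Kollár, *Shafarevich maps and automorphic forms* (Princeton 1995), Ch. 5;
W. Rudin, *Function Theory in the Unit Ball of ℂⁿ* (Springer 1980), Thm 2.2.2, 2.2.6.

## Provenance

Written for the pub-hodgecm2 cell (COR-CM, Hodge ladder stage 2), LIT-FANOUT-PLAN §D row D4 (c2)
(tangent separation, upstairs form): the analytic half of "compact ball quotients are projective"
(`PicardCM.BallQuotientUniformised`), complementing `UnitaryBallPoincareSeries.lean` (convergence) and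
the point-separation / automorphy files of the same programme. Everything here is PROVED; theorems
only — no definitions, no named facts.

## Not here

The automorphy relation and holomorphy of `P φ` as a member of `BallForms.holFactorForms`; separation
of POINTS (Lemma (A)); the descent to the quotient manifold `Δ\𝔹²` and the projective embedding
(Shafarevich's Theorem); finite-dimensionality of the spaces of forms.
-/

set_option autoImplicit false

noncomputable section

open Matrix Set Filter Topology
open Literature.Geometry.ComplexHyperbolic
open Literature.Geometry.ComplexHyperbolic.BallModel

namespace Literature.AlgebraicGeometry.ShimuraVarieties

namespace BallPoincare

open BallForms

/-! ### §1 Pointwise bounds at a point of the ball -/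

/-- **Lower bound for the automorphy factor**: `‖g₂₂‖ (1 - |z|) ≤ |(g·(z,1))₂|` (row identity of
`U(2,1)` and Cauchy–Schwarz); this is `BallPoincare.norm_22_mul_le_norm_W3` of
`UnitaryBallPoincareSeries`, reproved privately to keep this file independent of that module.
[cite: Rudin1980, Theorem 2.2.2 (v)] -/
private theorem corner_mul_one_sub_le_norm_W3 (g : U21) (z : Ball) :
    ‖mat g 2 2‖ * (1 - Real.sqrt (nsq z.1)) ≤ ‖W3 g z 2‖ := by
  have hrow := row_identity g 2
  simp only [if_true] at hrow
  have hle : Real.sqrt (‖mat g 2 0‖ ^ 2 + ‖mat g 2 1‖ ^ 2) ≤ ‖mat g 2 2‖ := by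
    refine Real.sqrt_le_iff.2 ⟨norm_nonneg _, ?_⟩
    linarith
  have hcs : ∀ a b x y : ℝ, a * x + b * y ≤ Real.sqrt (a ^ 2 + b ^ 2) * Real.sqrt (x ^ 2 + y ^ 2) := by
    intro a b x y
    rw [← Real.sqrt_mul (by positivity)]
    refine Real.le_sqrt_of_sq_le ?_
    nlinarith [sq_nonneg (a * y - b * x)]
  have h : ‖mat g 2 0 * z.1 0 + mat g 2 1 * z.1 1‖ ≤ ‖mat g 2 2‖ * Real.sqrt (nsq z.1) := by
    calc ‖mat g 2 0 * z.1 0 + mat g 2 1 * z.1 1‖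
        ≤ ‖mat g 2 0‖ * ‖z.1 0‖ + ‖mat g 2 1‖ * ‖z.1 1‖ := by
          refine (norm_add_le _ _).trans ?_
          rw [norm_mul, norm_mul]
      _ ≤ Real.sqrt (‖mat g 2 0‖ ^ 2 + ‖mat g 2 1‖ ^ 2) * Real.sqrt (‖z.1 0‖ ^ 2 + ‖z.1 1‖ ^ 2) :=
          hcs _ _ _ _
      _ ≤ ‖mat g 2 2‖ * Real.sqrt (nsq z.1) := by
          rw [nsq]
          exact mul_le_mul_of_nonneg_right hle (Real.sqrt_nonneg _)
  have hW : W3 g z 2 = mat g 2 2 + (mat g 2 0 * z.1 0 + mat g 2 1 * z.1 1) := by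
    rw [W3_apply]; ring
  have htri := norm_le_add_norm_add (mat g 2 2) (mat g 2 0 * z.1 0 + mat g 2 1 * z.1 1)
  rw [← hW] at htri
  nlinarith [norm_nonneg (mat g 2 2)]

/-- `|J(g, z)| = |(g·(z,1))₂|⁻³` (`det D(g)(z) = det g / w₂³`, `|det g| = 1`); this is
`BallPoincare.norm_canonicalFactor_eq` of `UnitaryBallPoincareSeries`, reproved privately.
[cite: Rudin1980, Theorem 2.2.6 (i), eq. (6)] -/
private theorem norm_canonicalFactor_eq_inv_cube (g : U21) (z : Ball) :
    ‖canonicalFactor g z‖ = (‖W3 g z 2‖ ^ 3)⁻¹ := by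
  rw [canonicalFactor, det_Jac, norm_div, norm_pow, norm_det_mat, one_div]

/-- `|z| < 1` on the ball. [folklore] -/
private theorem sqrt_nsq_lt_one (z : Ball) : Real.sqrt (nsq z.1) < 1 :=
  (Real.sqrt_lt_sqrt (nsq_nonneg _) z.2).trans_eq Real.sqrt_one

/-- `0 < 1 - |z|` on the ball. [folklore] -/
private theorem one_sub_sqrt_nsq_pos (z : Ball) : 0 < 1 - Real.sqrt (nsq z.1) := by
  linarith [sqrt_nsq_lt_one z]

/-- **The reciprocal of the automorphy factor**: `|(g·(z,1))₂|⁻¹ ≤ (1 - |z|)⁻¹ ‖g₂₂‖⁻¹`.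
[cite: Rudin1980, Theorem 2.2.2 (v)] -/
theorem inv_norm_W3_le (g : U21) (z : Ball) :
    ‖W3 g z 2‖⁻¹ ≤ (1 - Real.sqrt (nsq z.1))⁻¹ * ‖mat g 2 2‖⁻¹ := by
  have h := corner_mul_one_sub_le_norm_W3 g z
  have hr := one_sub_sqrt_nsq_pos z
  have h22 := norm_22_pos g
  rw [← mul_inv, mul_comm (1 - _)]
  exact inv_anti₀ (mul_pos h22 hr) h

/-- The homogeneous coordinates of `g·(z,1)` are dominated by the last one: `|wᵢ| ≤ |w₂|`
(`g z = (w₀/w₂, w₁/w₂)` lies in the ball). [folklore] -/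
private theorem norm_W3_castSucc_le (g : U21) (z : Ball) (i : Fin 2) :
    ‖W3 g z (Fin.castSucc i)‖ ≤ ‖W3 g z 2‖ := by
  have hmem := (g • z).2
  have hi : ‖(g • z).1 i‖ ^ 2 ≤ nsq (g • z).1 := by
    rw [nsq]
    fin_cases i
    · simp only [Fin.zero_eta, Fin.isValue, le_add_iff_nonneg_right]; positivity
    · simp only [Fin.mk_one, Fin.isValue, le_add_iff_nonneg_left]; positivity
  have hlt : ‖(g • z).1 i‖ < 1 := by
    have h1 : ‖(g • z).1 i‖ ^ 2 < 1 := lt_of_le_of_lt hi hmem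
    nlinarith [norm_nonneg ((g • z).1 i)]
  rw [smul_val, norm_div] at hlt
  have hpos : 0 < ‖W3 g z 2‖ := norm_pos_iff.2 (W3_2_ne_zero g z)
  exact ((div_lt_one hpos).1 hlt).le

/-- **Entry bound for the Jacobian**: `|Jac g z i j| ≤ 2 (1 - |z|)⁻¹`
(`Jac i j = (g_{ij} w₂ - wᵢ g_{2j})/w₂²` with `|g_{ij}| ≤ ‖g₂₂‖`, `|wᵢ| ≤ |w₂|`, `|w₂| ≥ ‖g₂₂‖ (1 - |z|)`).
[cite: Rudin1980, Theorem 2.2.2 (v)] -/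
theorem norm_Jac_apply_le (g : U21) (z : Ball) (i j : Fin 2) :
    ‖Jac g z i j‖ ≤ 2 * (1 - Real.sqrt (nsq z.1))⁻¹ := by
  have hW := norm_pos_iff.2 (W3_2_ne_zero g z)
  have hr := one_sub_sqrt_nsq_pos z
  have h22 := norm_22_pos g
  have hnum : ‖mat g (Fin.castSucc i) (Fin.castSucc j) * W3 g z 2 -
      W3 g z (Fin.castSucc i) * mat g 2 (Fin.castSucc j)‖ ≤ 2 * ‖mat g 2 2‖ * ‖W3 g z 2‖ := by
    refine (norm_sub_le _ _).trans ?_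
    rw [norm_mul, norm_mul]
    have h1 := norm_entry_le_norm_22 g (Fin.castSucc i) (Fin.castSucc j)
    have h2 := norm_entry_le_norm_22 g 2 (Fin.castSucc j)
    have h3 := norm_W3_castSucc_le g z i
    nlinarith [norm_nonneg (W3 g z 2), norm_nonneg (W3 g z (Fin.castSucc i)),
      norm_nonneg (mat g 2 (Fin.castSucc j)), norm_nonneg (mat g 2 2)]
  have hlow := corner_mul_one_sub_le_norm_W3 g z
  rw [Jac, Matrix.of_apply, norm_div, norm_pow, div_le_iff₀ (by positivity)]
  calc ‖mat g (Fin.castSucc i) (Fin.castSucc j) * W3 g z 2 -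
        W3 g z (Fin.castSucc i) * mat g 2 (Fin.castSucc j)‖
      ≤ 2 * ‖mat g 2 2‖ * ‖W3 g z 2‖ := hnum
    _ = 2 * (1 - Real.sqrt (nsq z.1))⁻¹ * ((‖mat g 2 2‖ * (1 - Real.sqrt (nsq z.1))) * ‖W3 g z 2‖) := by
        field_simp
    _ ≤ 2 * (1 - Real.sqrt (nsq z.1))⁻¹ * (‖W3 g z 2‖ * ‖W3 g z 2‖) := by
        gcongr
    _ = 2 * (1 - Real.sqrt (nsq z.1))⁻¹ * ‖W3 g z 2‖ ^ 2 := by ring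

/-- **Operator-norm bound for the Jacobian** (sup norm on `ℂ²`): `‖D(g)(z)‖ ≤ 4 (1 - |z|)⁻¹`.
[cite: Rudin1980, Theorem 2.2.2 (v)] -/
theorem norm_JacCLM_le (g : U21) (z : Ball) :
    ‖LinearMap.toContinuousLinearMap (Matrix.mulVecLin (Jac g z))‖ ≤
      4 * (1 - Real.sqrt (nsq z.1))⁻¹ := by
  have hr := one_sub_sqrt_nsq_pos z
  refine ContinuousLinearMap.opNorm_le_bound _ (by positivity) fun v ↦ ?_
  rw [pi_norm_le_iff_of_nonneg (by positivity)]
  intro i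
  simp only [LinearMap.coe_toContinuousLinearMap', Matrix.mulVecLin_apply, Matrix.mulVec,
    dotProduct, Fin.sum_univ_two]
  have h0 := norm_Jac_apply_le g z i 0
  have h1 := norm_Jac_apply_le g z i 1
  have hv0 : ‖v 0‖ ≤ ‖v‖ := norm_le_pi_norm v 0
  have hv1 : ‖v 1‖ ≤ ‖v‖ := norm_le_pi_norm v 1
  calc ‖Jac g z i 0 * v 0 + Jac g z i 1 * v 1‖
      ≤ ‖Jac g z i 0‖ * ‖v 0‖ + ‖Jac g z i 1‖ * ‖v 1‖ := by
        refine (norm_add_le _ _).trans ?_; rw [norm_mul, norm_mul]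
    _ ≤ 2 * (1 - Real.sqrt (nsq z.1))⁻¹ * ‖v‖ + 2 * (1 - Real.sqrt (nsq z.1))⁻¹ * ‖v‖ := by
        gcongr
    _ = 4 * (1 - Real.sqrt (nsq z.1))⁻¹ * ‖v‖ := by ring

/-- **Operator-norm bound for the linear part of the automorphy factor**: `‖y ↦ g₂₀ y₀ + g₂₁ y₁‖ ≤ 2 ‖g₂₂‖`.
[folklore] -/
private theorem norm_rowCLM_two_le (g : U21) : ‖rowCLM g 2‖ ≤ 2 * ‖mat g 2 2‖ := by
  refine ContinuousLinearMap.opNorm_le_bound _ (by positivity) fun y ↦ ?_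
  rw [rowCLM_apply]
  have h0 := norm_entry_le_norm_22 g 2 0
  have h1 := norm_entry_le_norm_22 g 2 1
  have hy0 : ‖y 0‖ ≤ ‖y‖ := norm_le_pi_norm y 0
  have hy1 : ‖y 1‖ ≤ ‖y‖ := norm_le_pi_norm y 1
  calc ‖mat g 2 0 * y 0 + mat g 2 1 * y 1‖
      ≤ ‖mat g 2 0‖ * ‖y 0‖ + ‖mat g 2 1‖ * ‖y 1‖ := by
        refine (norm_add_le _ _).trans ?_; rw [norm_mul, norm_mul]
    _ ≤ ‖mat g 2 2‖ * ‖y‖ + ‖mat g 2 2‖ * ‖y‖ := by gcongr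
    _ = 2 * ‖mat g 2 2‖ * ‖y‖ := by ring

/-! ### §1b From the lattice sum to the convergence of the series at a point -/

section LatticeSum

variable {G : Type*} [Group G] (ρ : G →* U21)

/-- **M-test bound** `|J(g, z)|ᵏ ≤ ((1 - |z|)⁻¹)³ᵏ (‖g₂₂‖³ᵏ)⁻¹`; this is
`BallPoincare.norm_canonicalFactor_pow_le` of `UnitaryBallPoincareSeries`, reproved privately.
[cite: Rudin1980, Theorem 2.2.6 (i), eq. (6)] -/
private theorem norm_canonicalFactor_pow_le' (g : U21) (z : Ball) (k : ℕ) :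
    ‖canonicalFactor g z‖ ^ k ≤
      ((1 - Real.sqrt (nsq z.1))⁻¹) ^ (3 * k) * (‖mat g 2 2‖ ^ (3 * k))⁻¹ := by
  have h1 : ‖canonicalFactor g z‖ ≤ ((1 - Real.sqrt (nsq z.1))⁻¹ * ‖mat g 2 2‖⁻¹) ^ 3 := by
    rw [norm_canonicalFactor_eq_inv_cube, ← inv_pow]
    exact pow_le_pow_left₀ (inv_nonneg.2 (norm_nonneg _)) (inv_norm_W3_le g z) 3
  have h2 := pow_le_pow_left₀ (norm_nonneg _) h1 k
  rw [← pow_mul, mul_pow] at h2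
  simpa only [← inv_pow] using h2

/-- **The lattice sum dominates `∑_γ |J(ρ γ, z)|²`**: if `∑_γ ‖(ρ γ)₂₂‖⁻⁶ < ∞` then
`∑_γ |J(ρ γ, z)|² < ∞` at every point of the ball (`|J| ≤ (1-|z|)⁻³ ‖g₂₂‖⁻³`).
[cite: Shafarevich1994, Ch. IX §3.1, Proposition] -/
theorem summable_sq_norm_canonicalFactor
    (hS : ∀ n : ℕ, 6 ≤ n → Summable fun γ : G ↦ (‖mat (ρ γ) 2 2‖ ^ n)⁻¹) (z : Ball) :
    Summable fun γ : G ↦ ‖canonicalFactor (ρ γ) z‖ ^ 2 :=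
  ((hS 6 le_rfl).mul_left (((1 - Real.sqrt (nsq z.1))⁻¹) ^ 6)).of_nonneg_of_le
    (fun γ ↦ by positivity) fun γ ↦ norm_canonicalFactor_pow_le' (ρ γ) z 2

/-- **The lattice sum dominates the Poincaré series**: if `∑_γ ‖(ρ γ)₂₂‖⁻ⁿ < ∞` for `n ≥ 6` then for
`k ≥ 2` and bounded `φ` the series `∑_γ J(ρ γ, z)ᵏ φ(ρ γ z)` converges absolutely at every point.
[cite: Shafarevich1994, Ch. IX §3.1, Proposition] -/
theorem summable_term_of_latticeSum
    (hS : ∀ n : ℕ, 6 ≤ n → Summable fun γ : G ↦ (‖mat (ρ γ) 2 2‖ ^ n)⁻¹) {k : ℕ} (hk : 2 ≤ k)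
    {φ : Ball → ℂ} {B : ℝ} (hφ : ∀ z, ‖φ z‖ ≤ B) (z : Ball) :
    Summable fun γ : G ↦ canonicalFactor (ρ γ) z ^ k * φ (ρ γ • z) := by
  have hB : 0 ≤ B := (norm_nonneg _).trans (hφ z)
  have hA : 0 ≤ (1 - Real.sqrt (nsq z.1))⁻¹ := inv_nonneg.2 (one_sub_sqrt_nsq_pos z).le
  refine Summable.of_norm_bounded
    (g := fun γ ↦ ((1 - Real.sqrt (nsq z.1))⁻¹) ^ (3 * k) * (‖mat (ρ γ) 2 2‖ ^ (3 * k))⁻¹ * B)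
    (((hS (3 * k) (by omega)).mul_left _).mul_right B) fun γ ↦ ?_
  rw [norm_mul, norm_pow]
  exact mul_le_mul (norm_canonicalFactor_pow_le' (ρ γ) z k) (hφ _) (norm_nonneg _)
    (mul_nonneg (pow_nonneg hA _) (inv_nonneg.2 (pow_nonneg (norm_nonneg _) _)))

end LatticeSum

/-! ### §2 The terms of the Poincaré series as functions on `ℂ²` and their derivatives -/

/-- On the ball the ambient Jacobian determinant is the canonical automorphy factor
`J(g, z) = det D(g)(z)`. [folklore] -/
private theorem det_JacAmb_coe (g : U21) (z : Ball) : (JacAmb g z.1).det = canonicalFactor g z := rfl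

/-- On the ball the ambient term `J̃(g, y)ᵏ φ̃(g y)` is the term `J(g, z)ᵏ φ(g z)` of the Poincaré series.
[folklore] -/
private theorem term_coe (g : U21) (k : ℕ) (φ : Ball → ℂ) (z : Ball) :
    (JacAmb g z.1).det ^ k * extend ℂ φ (actVec g z.1) = canonicalFactor g z ^ k * φ (g • z) := by
  rw [det_JacAmb_coe, actVec_eq, extend_apply_coe]

/-- Near a point of the ball, `det J̃(g, y) = det g / (g·(y,1))₂³`. [folklore] -/
private theorem det_JacAmb_eventuallyEq (g : U21) (z : Ball) :
    (fun y ↦ (JacAmb g y).det) =ᶠ[𝓝 z.1]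
      fun y ↦ (mat g).det * ((mat g *ᵥ ![y 0, y 1, 1]) 2 ^ 3)⁻¹ := by
  filter_upwards [isOpen_ballSet.mem_nhds (coe_mem_ballSet z)] with y hy
  change (JacAmb g (⟨y, hy⟩ : Ball).1).det = _
  rw [JacAmb_coe, det_Jac, div_eq_mul_inv]
  rfl

/-- **Derivative of the automorphy factor**: `y ↦ det J̃(g, y)` has derivative
`(-3 det g / w₂⁴) · (y ↦ g₂₀ y₀ + g₂₁ y₁)` at a point `z` of the ball (`w₂ = (g·(z,1))₂`; the derivative of
Rudin's `J(ψ, z) = det ψ'(z) = det g / w₂³`). [cite: Rudin1980, Theorem 2.2.6 (i), eq. (6)] -/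
theorem hasFDerivAt_det_JacAmb (g : U21) (z : Ball) :
    HasFDerivAt (fun y ↦ (JacAmb g y).det)
      ((-3 * (mat g).det / W3 g z 2 ^ 4) • rowCLM g 2) z.1 := by
  have hW : W3 g z 2 ≠ 0 := W3_2_ne_zero g z
  have hh := hasFDerivAt_homog g 2 z.1
  have hW' : (mat g *ᵥ ![z.1 0, z.1 1, 1]) 2 = W3 g z 2 := rfl
  -- derivative of `y ↦ ((g·(y,1))₂ ^ 3)⁻¹`
  have hpow := hh.pow 3
  have hne : (mat g *ᵥ ![z.1 0, z.1 1, 1]) 2 ^ 3 ≠ 0 := by rw [hW']; exact pow_ne_zero 3 hW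
  have hinv := (hasFDerivAt_inv hne).comp z.1 hpow
  have hmul := hinv.const_mul (mat g).det
  refine (hmul.congr_of_eventuallyEq (det_JacAmb_eventuallyEq g z)).congr_fderiv ?_
  ext y
  simp only [hW', _root_.smul_apply, ContinuousLinearMap.coe_comp, Function.comp_apply,
    ContinuousLinearMap.toSpanSingleton_apply, smul_eq_mul, FunLike.coe_smul,
    Pi.smul_apply, nsmul_eq_mul, Nat.cast_ofNat]
  field_simp
  ring

/-- The derivative of the automorphy factor vanishes for `g = 1` (`J̃(1, y) = 1`). [folklore] -/
private theorem rowCLM_one_two : rowCLM 1 2 = 0 := by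
  ext y; simp [rowCLM_apply]

/-- **Derivative of the pulled-back test function**: for holomorphic `φ` on the ball,
`y ↦ φ̃(g y)` has derivative `Dφ̃(g z) ∘ D(g)(z)` at `z`. [folklore] -/
private theorem hasFDerivAt_extend_comp_actVec (g : U21) {φ : Ball → ℂ} (hφ : φ ∈ holomorphic ℂ) (z : Ball) :
    HasFDerivAt (fun y ↦ extend ℂ φ (actVec g y))
      ((fderiv ℂ (extend ℂ φ) (g • z).1).comp
        (LinearMap.toContinuousLinearMap (Matrix.mulVecLin (Jac g z)))) z.1 := by
  have hd : HasFDerivAt (extend ℂ φ) (fderiv ℂ (extend ℂ φ) (g • z).1) (actVec g z.1) := by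
    rw [actVec_eq]
    exact (differentiableAt_extend hφ (g • z)).hasFDerivAt
  exact hd.comp z.1 (hasFDerivAt_actVec g z)

/-- **Derivative of one term of the Poincaré series** `y ↦ J̃(g, y)ᵏ φ̃(g y)` at a point `z` of the
ball: `k J^{k-1} φ(g z) · DJ + Jᵏ · (Dφ̃(g z) ∘ D(g)(z))`. [cite: Shafarevich1994, Ch. IX §3.2, Lemma (B)] -/
theorem hasFDerivAt_term (g : U21) (k : ℕ) {φ : Ball → ℂ} (hφ : φ ∈ holomorphic ℂ) (z : Ball) :
    HasFDerivAt (fun y ↦ (JacAmb g y).det ^ k * extend ℂ φ (actVec g y))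
      (((k : ℂ) * canonicalFactor g z ^ (k - 1) * φ (g • z)) •
          ((-3 * (mat g).det / W3 g z 2 ^ 4) • rowCLM g 2) +
        canonicalFactor g z ^ k •
          ((fderiv ℂ (extend ℂ φ) (g • z).1).comp
            (LinearMap.toContinuousLinearMap (Matrix.mulVecLin (Jac g z))))) z.1 := by
  have h1 := (hasFDerivAt_det_JacAmb g z).pow k
  have h2 := hasFDerivAt_extend_comp_actVec g hφ z
  refine (h1.mul h2).congr_fderiv ?_
  rw [det_JacAmb_coe, actVec_eq, extend_apply_coe, nsmul_eq_mul, smul_smul, add_comm]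
  congr 1
  rw [mul_comm (φ (g • z)), smul_smul]


/-! ### §3 The size of the termwise derivative -/

/-- `|J(g, z)| = (|(g·(z,1))₂|⁻¹)³`. [cite: Rudin1980, Theorem 2.2.6 (i), eq. (6)] -/
private theorem norm_canonicalFactor_eq_inv_pow (g : U21) (z : Ball) :
    ‖canonicalFactor g z‖ = (‖W3 g z 2‖⁻¹) ^ 3 := by
  rw [norm_canonicalFactor_eq_inv_cube, inv_pow]

/-- The scalar in the derivative of the automorphy factor has norm `3 |w₂|⁻⁴`. [folklore] -/
private theorem norm_deriv_scalar (g : U21) (z : Ball) :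
    ‖(-3 * (mat g).det / W3 g z 2 ^ 4 : ℂ)‖ = 3 * (‖W3 g z 2‖⁻¹) ^ 4 := by
  rw [norm_div, norm_mul, norm_neg, norm_det_mat, mul_one, norm_pow, div_eq_mul_inv, ← inv_pow]
  simp

/-- **Bound for the derivative of one term** (`k ≥ 1`, `|φ| ≤ B`, `‖Dφ̃‖ ≤ B'` on the ball):
`‖D(J̃ᵏ φ̃∘g)(z)‖ ≤ (6 k B + 4 B') (1 - |z|)^{-(3k+1)} ‖g₂₂‖^{-3k}` — the M-test majorant of the
differentiated Poincaré series. [cite: Shafarevich1994, Ch. IX §3.1, Proposition] -/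
theorem norm_termDeriv_le (g : U21) {k : ℕ} (hk : 1 ≤ k) {φ : Ball → ℂ} {B B' : ℝ}
    (hφ : ∀ z, ‖φ z‖ ≤ B) (hφ' : ∀ z : Ball, ‖fderiv ℂ (extend ℂ φ) z.1‖ ≤ B') (z : Ball) :
    ‖((k : ℂ) * canonicalFactor g z ^ (k - 1) * φ (g • z)) •
          ((-3 * (mat g).det / W3 g z 2 ^ 4) • rowCLM g 2) +
        canonicalFactor g z ^ k •
          ((fderiv ℂ (extend ℂ φ) (g • z).1).comp
            (LinearMap.toContinuousLinearMap (Matrix.mulVecLin (Jac g z))))‖ ≤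
      (6 * k * B + 4 * B') * ((1 - Real.sqrt (nsq z.1))⁻¹) ^ (3 * k + 1) *
        (‖mat g 2 2‖ ^ (3 * k))⁻¹ := by
  have hB : 0 ≤ B := (norm_nonneg _).trans (hφ z)
  have hB' : 0 ≤ B' := (norm_nonneg _).trans (hφ' z)
  have hr := one_sub_sqrt_nsq_pos z
  have h22 := norm_22_pos g
  set A : ℝ := (1 - Real.sqrt (nsq z.1))⁻¹ with hA
  set n : ℝ := ‖mat g 2 2‖ with hn
  set x : ℝ := ‖W3 g z 2‖⁻¹ with hx
  have hA0 : 0 < A := inv_pos.2 hr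
  have hx0 : 0 ≤ x := inv_nonneg.2 (norm_nonneg _)
  have hxle : x ≤ A * n⁻¹ := inv_norm_W3_le g z
  have hJ : ‖canonicalFactor g z‖ = x ^ 3 := norm_canonicalFactor_eq_inv_pow g z
  -- the two pieces
  have hT1 : ‖((k : ℂ) * canonicalFactor g z ^ (k - 1) * φ (g • z)) •
      ((-3 * (mat g).det / W3 g z 2 ^ 4) • rowCLM g 2)‖ ≤ 6 * k * B * (x ^ (3 * k + 1) * n) := by
    rw [norm_smul, norm_smul, norm_mul, norm_mul, norm_pow, hJ, norm_deriv_scalar, ← hx,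
      Complex.norm_natCast]
    have hrow := norm_rowCLM_two_le g
    rw [← hn] at hrow
    have hpow : (x ^ 3) ^ (k - 1) * x ^ 4 = x ^ (3 * k + 1) := by
      rw [← pow_mul, ← pow_add]
      congr 1
      omega
    calc (k : ℝ) * (x ^ 3) ^ (k - 1) * ‖φ (g • z)‖ * (3 * x ^ 4 * ‖rowCLM g 2‖)
        ≤ (k : ℝ) * (x ^ 3) ^ (k - 1) * B * (3 * x ^ 4 * (2 * n)) := by gcongr; exact hφ _
      _ = 6 * k * B * ((x ^ 3) ^ (k - 1) * x ^ 4 * n) := by ring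
      _ = 6 * k * B * (x ^ (3 * k + 1) * n) := by rw [hpow]
  have hT2 : ‖canonicalFactor g z ^ k • ((fderiv ℂ (extend ℂ φ) (g • z).1).comp
      (LinearMap.toContinuousLinearMap (Matrix.mulVecLin (Jac g z))))‖ ≤
      x ^ (3 * k) * (B' * (4 * A)) := by
    rw [norm_smul, norm_pow, hJ, ← pow_mul]
    gcongr
    exact (ContinuousLinearMap.opNorm_comp_le _ _).trans
      (mul_le_mul (hφ' _) (norm_JacCLM_le g z) (norm_nonneg _) hB')
  -- compare powers of `x` with powers of `A / n`
  have hx1 : x ^ (3 * k + 1) * n ≤ A ^ (3 * k + 1) * (n ^ (3 * k))⁻¹ := by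
    have h := pow_le_pow_left₀ hx0 hxle (3 * k + 1)
    rw [mul_pow, inv_pow n (3 * k + 1)] at h
    calc x ^ (3 * k + 1) * n ≤ A ^ (3 * k + 1) * (n ^ (3 * k + 1))⁻¹ * n :=
          mul_le_mul_of_nonneg_right h h22.le
      _ = A ^ (3 * k + 1) * (n ^ (3 * k))⁻¹ := by
          rw [pow_succ n (3 * k), mul_inv, mul_assoc, mul_assoc, inv_mul_cancel₀ h22.ne', mul_one]
  have hx2 : x ^ (3 * k) * (B' * (4 * A)) ≤ 4 * B' * (A ^ (3 * k + 1) * (n ^ (3 * k))⁻¹) := by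
    have h := pow_le_pow_left₀ hx0 hxle (3 * k)
    rw [mul_pow, inv_pow n (3 * k)] at h
    calc x ^ (3 * k) * (B' * (4 * A)) ≤ A ^ (3 * k) * (n ^ (3 * k))⁻¹ * (B' * (4 * A)) :=
          mul_le_mul_of_nonneg_right h (by positivity)
      _ = 4 * B' * (A ^ (3 * k + 1) * (n ^ (3 * k))⁻¹) := by rw [pow_succ]; ring
  calc _ ≤ 6 * k * B * (x ^ (3 * k + 1) * n) + x ^ (3 * k) * (B' * (4 * A)) :=
        (norm_add_le _ _).trans (add_le_add hT1 hT2)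
    _ ≤ 6 * k * B * (A ^ (3 * k + 1) * (n ^ (3 * k))⁻¹) +
          4 * B' * (A ^ (3 * k + 1) * (n ^ (3 * k))⁻¹) := by
        gcongr
    _ = (6 * k * B + 4 * B') * A ^ (3 * k + 1) * (n ^ (3 * k))⁻¹ := by ring

/-! ### §4 The Poincaré series is differentiable, with the termwise derivative -/

section Series

variable {G : Type*} [Group G] (ρ : G →* U21)

/-- A neighbourhood of a point of the ball on which `|y|² < r` for some `r < 1`: an open sup-norm
ball around `z₀` contained in `{|y|² < (1 + |z₀|²)/2}`. [folklore] -/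
private theorem exists_ball_subset (z₀ : Ball) :
    ∃ δ > 0, ∀ y ∈ Metric.ball z₀.1 δ, nsq y < (1 + nsq z₀.1) / 2 := by
  have hopen : IsOpen {y : Fin 2 → ℂ | nsq y < (1 + nsq z₀.1) / 2} :=
    isOpen_lt continuous_fun_nsq continuous_const
  have hmem : z₀.1 ∈ {y : Fin 2 → ℂ | nsq y < (1 + nsq z₀.1) / 2} := by
    change nsq z₀.1 < (1 + nsq z₀.1) / 2
    linarith [z₀.2]
  obtain ⟨δ, hδ, hsub⟩ := Metric.isOpen_iff.1 hopen z₀.1 hmem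
  exact ⟨δ, hδ, fun y hy ↦ hsub hy⟩

/-- **Termwise differentiation of the Poincaré series** (`k ≥ 2`, `φ` holomorphic with `|φ| ≤ B`,
`‖Dφ̃‖ ≤ B'` on the ball): at every `z₀ ∈ 𝔹²` the zero extension of
`P φ = ∑_γ J(ρ γ, ·)ᵏ φ(ρ γ ·)` has the derivative `∑_γ D(J̃ᵏ φ̃∘(ρ γ))(z₀)` — Weierstrass M-test for
the differentiated series on a neighbourhood of `z₀` (majorant `∝ ‖(ρ γ)₂₂‖^{-3k}`).
[cite: Shafarevich1994, Ch. IX §3.1, Proposition] -/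
theorem hasFDerivAt_extend_poincareSeries
    (hS : ∀ n : ℕ, 6 ≤ n → Summable fun γ : G ↦ (‖mat (ρ γ) 2 2‖ ^ n)⁻¹)
    {k : ℕ} (hk : 2 ≤ k) {φ : Ball → ℂ} (hφh : φ ∈ holomorphic ℂ) {B B' : ℝ}
    (hφ : ∀ z, ‖φ z‖ ≤ B) (hφ' : ∀ z : Ball, ‖fderiv ℂ (extend ℂ φ) z.1‖ ≤ B') (z₀ : Ball) :
    HasFDerivAt (extend ℂ fun z ↦ ∑' γ : G, canonicalFactor (ρ γ) z ^ k * φ (ρ γ • z))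
      (∑' γ : G, (((k : ℂ) * canonicalFactor (ρ γ) z₀ ^ (k - 1) * φ (ρ γ • z₀)) •
          ((-3 * (mat (ρ γ)).det / W3 (ρ γ) z₀ 2 ^ 4) • rowCLM (ρ γ) 2) +
        canonicalFactor (ρ γ) z₀ ^ k •
          ((fderiv ℂ (extend ℂ φ) (ρ γ • z₀).1).comp
            (LinearMap.toContinuousLinearMap (Matrix.mulVecLin (Jac (ρ γ) z₀))))))
      z₀.1 := by
  -- the neighbourhood
  obtain ⟨δ, hδ, hball⟩ := exists_ball_subset z₀
  set r : ℝ := (1 + nsq z₀.1) / 2 with hr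
  have hr1 : r < 1 := by rw [hr]; linarith [z₀.2]
  have hr0 : 0 ≤ r := by rw [hr]; linarith [nsq_nonneg z₀.1]
  set s : Set (Fin 2 → ℂ) := Metric.ball z₀.1 δ with hs
  have hs_open : IsOpen s := Metric.isOpen_ball
  have hs_conn : IsPreconnected s := (convex_ball z₀.1 δ).isPreconnected
  have hz₀s : z₀.1 ∈ s := Metric.mem_ball_self hδ
  have hs1 : ∀ y ∈ s, nsq y < 1 := fun y hy ↦ (hball y hy).trans hr1
  -- the uniform constant on `s`
  set A : ℝ := (1 - Real.sqrt r)⁻¹ with hA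
  have hAr : 0 < 1 - Real.sqrt r := by
    have : Real.sqrt r < 1 := (Real.sqrt_lt' one_pos).2 (by rw [one_pow]; exact hr1)
    linarith
  have hA0 : 0 < A := inv_pos.2 hAr
  have hAy : ∀ y ∈ s, (1 - Real.sqrt (nsq y))⁻¹ ≤ A := fun y hy ↦ by
    have h1 : Real.sqrt (nsq y) ≤ Real.sqrt r := Real.sqrt_le_sqrt (hball y hy).le
    exact inv_anti₀ hAr (by linarith)
  have hB : 0 ≤ B := (norm_nonneg _).trans (hφ z₀)
  have hB' : 0 ≤ B' := (norm_nonneg _).trans (hφ' z₀)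
  have hk1 : 1 ≤ k := by omega
  -- the terms, their derivatives and the majorant
  set f : G → (Fin 2 → ℂ) → ℂ := fun γ y ↦
    (JacAmb (ρ γ) y).det ^ k * extend ℂ φ (actVec (ρ γ) y) with hf
  set f' : G → (Fin 2 → ℂ) → ((Fin 2 → ℂ) →L[ℂ] ℂ) := fun γ y ↦
    if h : nsq y < 1 then
      (let z : Ball := ⟨y, h⟩;
        (((k : ℂ) * canonicalFactor (ρ γ) z ^ (k - 1) * φ (ρ γ • z)) •
          ((-3 * (mat (ρ γ)).det / W3 (ρ γ) z 2 ^ 4) • rowCLM (ρ γ) 2) +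
        canonicalFactor (ρ γ) z ^ k •
          ((fderiv ℂ (extend ℂ φ) (ρ γ • z).1).comp
            (LinearMap.toContinuousLinearMap (Matrix.mulVecLin (Jac (ρ γ) z))))))
    else 0 with hf'
  set u : G → ℝ := fun γ ↦ (6 * k * B + 4 * B') * A ^ (3 * k + 1) *
    (‖mat (ρ γ) 2 2‖ ^ (3 * k))⁻¹ with hu
  have hu_sum : Summable u := (hS (3 * k) (by omega)).mul_left _
  have hff' : ∀ γ y, y ∈ s → HasFDerivAt (f γ) (f' γ y) y := fun γ y hy ↦ by
    have hy1 := hs1 y hy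
    simp only [hf', dif_pos hy1]
    exact hasFDerivAt_term (ρ γ) k hφh ⟨y, hy1⟩
  have hf'u : ∀ γ y, y ∈ s → ‖f' γ y‖ ≤ u γ := fun γ y hy ↦ by
    have hy1 := hs1 y hy
    simp only [hf', dif_pos hy1, hu]
    refine (norm_termDeriv_le (ρ γ) hk1 hφ hφ' ⟨y, hy1⟩).trans ?_
    have hAy' : ((1 - Real.sqrt (nsq y))⁻¹) ^ (3 * k + 1) ≤ A ^ (3 * k + 1) :=
      pow_le_pow_left₀ (inv_nonneg.2 (one_sub_sqrt_nsq_pos ⟨y, hy1⟩).le) (hAy y hy) _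
    have hc : 0 ≤ 6 * (k : ℝ) * B + 4 * B' := by positivity
    gcongr
  have hf0 : Summable fun γ ↦ f γ z₀.1 :=
    (summable_term_of_latticeSum ρ hS hk hφ z₀).congr fun γ ↦ (term_coe (ρ γ) k φ z₀).symm
  have H := hasFDerivAt_tsum_of_isPreconnected hu_sum hs_open hs_conn hff' hf'u hz₀s hf0 hz₀s
  -- identify the derivative at `z₀` and the function near `z₀`
  have hz₀1 : nsq z₀.1 < 1 := z₀.2
  simp only [hf', dif_pos hz₀1] at H
  refine H.congr_of_eventuallyEq ?_
  filter_upwards [hs_open.mem_nhds hz₀s] with y hy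
  have hy1 := hs1 y hy
  rw [show y = (⟨y, hy1⟩ : Ball).1 from rfl, extend_apply_coe]
  exact tsum_congr fun γ ↦ (term_coe (ρ γ) k φ ⟨y, hy1⟩).symm

end Series

/-! ### §5 The limit `k → ∞` at a point: the identity term dominates -/

section Limit

variable {G : Type*} [Group G] (ρ : G →* U21)

/-- **Second bound for the derivative of one term**, at a fixed point `z` (`k ≥ 1`):
`‖D(J̃ᵏ φ̃∘g)(z)‖ ≤ 6 A⁴ B · k |J(g,z)|^{k-1} + 4 A B' · |J(g,z)|ᵏ` with `A = (1 - |z|)⁻¹`.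
[cite: Shafarevich1994, Ch. IX §3.2, Lemma (B)] -/
theorem norm_termDeriv_le' (g : U21) {k : ℕ} (hk : 1 ≤ k) {φ : Ball → ℂ} {B B' : ℝ}
    (hφ : ∀ z, ‖φ z‖ ≤ B) (hφ' : ∀ z : Ball, ‖fderiv ℂ (extend ℂ φ) z.1‖ ≤ B') (z : Ball) :
    ‖((k : ℂ) * canonicalFactor g z ^ (k - 1) * φ (g • z)) •
          ((-3 * (mat g).det / W3 g z 2 ^ 4) • rowCLM g 2) +
        canonicalFactor g z ^ k •
          ((fderiv ℂ (extend ℂ φ) (g • z).1).comp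
            (LinearMap.toContinuousLinearMap (Matrix.mulVecLin (Jac g z))))‖ ≤
      6 * ((1 - Real.sqrt (nsq z.1))⁻¹) ^ 4 * B * (k * ‖canonicalFactor g z‖ ^ (k - 1)) +
        4 * (1 - Real.sqrt (nsq z.1))⁻¹ * B' * ‖canonicalFactor g z‖ ^ k := by
  have hB : 0 ≤ B := (norm_nonneg _).trans (hφ z)
  have hB' : 0 ≤ B' := (norm_nonneg _).trans (hφ' z)
  have hr := one_sub_sqrt_nsq_pos z
  have h22 := norm_22_pos g
  have h1n := one_le_norm_22 g
  set A : ℝ := (1 - Real.sqrt (nsq z.1))⁻¹ with hA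
  set n : ℝ := ‖mat g 2 2‖ with hn
  set x : ℝ := ‖W3 g z 2‖⁻¹ with hx
  have hA0 : 0 < A := inv_pos.2 hr
  have hx0 : 0 ≤ x := inv_nonneg.2 (norm_nonneg _)
  have hxle : x ≤ A * n⁻¹ := inv_norm_W3_le g z
  have hxA : x ≤ A := hxle.trans (by
    calc A * n⁻¹ ≤ A * 1 := by gcongr; exact inv_le_one_of_one_le₀ h1n
      _ = A := mul_one A)
  -- `x⁴ n ≤ A⁴`
  have hx4 : x ^ 4 * n ≤ A ^ 4 := by
    have h := pow_le_pow_left₀ hx0 hxle 4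
    rw [mul_pow, inv_pow n 4] at h
    have hn3 : 1 ≤ n ^ 3 := one_le_pow₀ h1n
    calc x ^ 4 * n ≤ A ^ 4 * (n ^ 4)⁻¹ * n := mul_le_mul_of_nonneg_right h h22.le
      _ = A ^ 4 * (n ^ 3)⁻¹ := by
          rw [pow_succ n 3, mul_inv, mul_assoc, mul_assoc, inv_mul_cancel₀ h22.ne', mul_one]
      _ ≤ A ^ 4 * 1 := by gcongr; exact inv_le_one_of_one_le₀ hn3
      _ = A ^ 4 := mul_one _
  have hT1 : ‖((k : ℂ) * canonicalFactor g z ^ (k - 1) * φ (g • z)) •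
      ((-3 * (mat g).det / W3 g z 2 ^ 4) • rowCLM g 2)‖ ≤
      6 * A ^ 4 * B * (k * ‖canonicalFactor g z‖ ^ (k - 1)) := by
    rw [norm_smul, norm_smul, norm_mul, norm_mul, norm_pow, norm_deriv_scalar, ← hx,
      Complex.norm_natCast]
    have hrow := norm_rowCLM_two_le g
    rw [← hn] at hrow
    calc (k : ℝ) * ‖canonicalFactor g z‖ ^ (k - 1) * ‖φ (g • z)‖ * (3 * x ^ 4 * ‖rowCLM g 2‖)
        ≤ (k : ℝ) * ‖canonicalFactor g z‖ ^ (k - 1) * B * (3 * x ^ 4 * (2 * n)) := by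
          gcongr; exact hφ _
      _ = 6 * (x ^ 4 * n) * B * (k * ‖canonicalFactor g z‖ ^ (k - 1)) := by ring
      _ ≤ 6 * A ^ 4 * B * (k * ‖canonicalFactor g z‖ ^ (k - 1)) := by gcongr
  have hT2 : ‖canonicalFactor g z ^ k • ((fderiv ℂ (extend ℂ φ) (g • z).1).comp
      (LinearMap.toContinuousLinearMap (Matrix.mulVecLin (Jac g z))))‖ ≤
      4 * A * B' * ‖canonicalFactor g z‖ ^ k := by
    rw [norm_smul, norm_pow]
    calc ‖canonicalFactor g z‖ ^ k * ‖(fderiv ℂ (extend ℂ φ) (g • z).1).comp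
          (LinearMap.toContinuousLinearMap (Matrix.mulVecLin (Jac g z)))‖
        ≤ ‖canonicalFactor g z‖ ^ k * (B' * (4 * A)) := by
          gcongr
          exact (ContinuousLinearMap.opNorm_comp_le _ _).trans
            (mul_le_mul (hφ' _) (norm_JacCLM_le g z) (norm_nonneg _) hB')
      _ = 4 * A * B' * ‖canonicalFactor g z‖ ^ k := by ring
  have _ := hk
  exact (norm_add_le _ _).trans (add_le_add hT1 hT2)

/-- `k ≤ 3 · 2^{k-3}` for `k ≥ 3`, in the form `k (1/2)^{k-3} ≤ 3`. [folklore] -/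
private theorem nat_mul_half_pow_le (k : ℕ) (hk : 3 ≤ k) : (k : ℝ) * (1 / 2) ^ (k - 3) ≤ 3 := by
  obtain ⟨m, rfl⟩ := Nat.exists_eq_add_of_le hk
  rw [Nat.add_sub_cancel_left]
  have h : ∀ m : ℕ, ((3 + m : ℕ) : ℝ) ≤ 3 * 2 ^ m := by
    intro m
    induction m with
    | zero => norm_num
    | succ m ih =>
        rw [pow_succ]
        push_cast at ih ⊢
        have : (1 : ℝ) ≤ 2 ^ m := one_le_pow₀ (by norm_num)
        linarith
  have h2 : (0 : ℝ) < 2 ^ m := by positivity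
  rw [one_div, inv_pow, ← div_eq_mul_inv, div_le_iff₀ h2]
  exact h m

/-- **Domination at a point off the exceptional set** (`|J(g,z)| ≤ 1/2`, `k ≥ 3`):
`‖D(J̃ᵏ φ̃∘g)(z)‖ ≤ (18 A⁴ B + 4 A B') |J(g,z)|²`. [cite: Shafarevich1994, Ch. IX §3.2, Lemma (B)] -/
theorem norm_termDeriv_le_sq (g : U21) {k : ℕ} (hk : 3 ≤ k) {φ : Ball → ℂ} {B B' : ℝ}
    (hφ : ∀ z, ‖φ z‖ ≤ B) (hφ' : ∀ z : Ball, ‖fderiv ℂ (extend ℂ φ) z.1‖ ≤ B') (z : Ball)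
    (hJ : ‖canonicalFactor g z‖ ≤ 1 / 2) :
    ‖((k : ℂ) * canonicalFactor g z ^ (k - 1) * φ (g • z)) •
          ((-3 * (mat g).det / W3 g z 2 ^ 4) • rowCLM g 2) +
        canonicalFactor g z ^ k •
          ((fderiv ℂ (extend ℂ φ) (g • z).1).comp
            (LinearMap.toContinuousLinearMap (Matrix.mulVecLin (Jac g z))))‖ ≤
      (18 * ((1 - Real.sqrt (nsq z.1))⁻¹) ^ 4 * B + 4 * (1 - Real.sqrt (nsq z.1))⁻¹ * B') *
        ‖canonicalFactor g z‖ ^ 2 := by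
  have hB : 0 ≤ B := (norm_nonneg _).trans (hφ z)
  have hB' : 0 ≤ B' := (norm_nonneg _).trans (hφ' z)
  have hA0 : 0 < (1 - Real.sqrt (nsq z.1))⁻¹ := inv_pos.2 (one_sub_sqrt_nsq_pos z)
  set J : ℝ := ‖canonicalFactor g z‖ with hJdef
  have hJ0 : 0 ≤ J := norm_nonneg _
  have hJ1 : J ≤ 1 := hJ.trans (by norm_num)
  refine (norm_termDeriv_le' g (by omega) hφ hφ' z).trans ?_
  rw [← hJdef]
  -- `k J^{k-1} ≤ 3 J²` and `J^k ≤ J²`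
  have h1 : (k : ℝ) * J ^ (k - 1) ≤ 3 * J ^ 2 := by
    have hsplit : J ^ (k - 1) = J ^ (k - 3) * J ^ 2 := by
      rw [← pow_add]; congr 1; omega
    have hle : J ^ (k - 3) ≤ (1 / 2) ^ (k - 3) := pow_le_pow_left₀ hJ0 hJ _
    calc (k : ℝ) * J ^ (k - 1) = (k * J ^ (k - 3)) * J ^ 2 := by rw [hsplit, mul_assoc]
      _ ≤ (k * (1 / 2) ^ (k - 3)) * J ^ 2 := by gcongr
      _ ≤ 3 * J ^ 2 := by gcongr; exact nat_mul_half_pow_le k hk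
  have h2 : J ^ k ≤ J ^ 2 := pow_le_pow_of_le_one hJ0 hJ1 (by omega)
  calc 6 * ((1 - Real.sqrt (nsq z.1))⁻¹) ^ 4 * B * (k * J ^ (k - 1)) +
        4 * (1 - Real.sqrt (nsq z.1))⁻¹ * B' * J ^ k
      ≤ 6 * ((1 - Real.sqrt (nsq z.1))⁻¹) ^ 4 * B * (3 * J ^ 2) +
        4 * (1 - Real.sqrt (nsq z.1))⁻¹ * B' * J ^ 2 := by gcongr
    _ = _ := by ring

/-- **Each non-identity term's derivative tends to zero** when `|J(g,z)| < 1`: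
`k |J|^{k-1} → 0` and `|J|ᵏ → 0`. [cite: Shafarevich1994, Ch. IX §3.2, Lemma (B)] -/
theorem tendsto_termDeriv_of_norm_lt_one (g : U21) {φ : Ball → ℂ} {B B' : ℝ}
    (hφ : ∀ z, ‖φ z‖ ≤ B) (hφ' : ∀ z : Ball, ‖fderiv ℂ (extend ℂ φ) z.1‖ ≤ B') (z : Ball)
    (hJ : ‖canonicalFactor g z‖ < 1) :
    Tendsto (fun k : ℕ ↦ ((k : ℂ) * canonicalFactor g z ^ (k - 1) * φ (g • z)) •
          ((-3 * (mat g).det / W3 g z 2 ^ 4) • rowCLM g 2) +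
        canonicalFactor g z ^ k •
          ((fderiv ℂ (extend ℂ φ) (g • z).1).comp
            (LinearMap.toContinuousLinearMap (Matrix.mulVecLin (Jac g z)))))
      atTop (𝓝 0) := by
  set J : ℝ := ‖canonicalFactor g z‖ with hJdef
  have hJpos : 0 < J := norm_pos_iff.2 (canonicalFactor_ne_zero g z)
  set A : ℝ := (1 - Real.sqrt (nsq z.1))⁻¹ with hA
  -- the bound `6 A⁴ B J⁻¹ (k Jᵏ) + 4 A B' Jᵏ → 0`
  have hlim : Tendsto (fun k : ℕ ↦ 6 * A ^ 4 * B * (J⁻¹ * ((k : ℝ) * J ^ k)) + 4 * A * B' * J ^ k)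
      atTop (𝓝 0) := by
    have h1 := tendsto_self_mul_const_pow_of_lt_one hJpos.le hJ
    have h2 := tendsto_pow_atTop_nhds_zero_of_lt_one hJpos.le hJ
    have := ((h1.const_mul J⁻¹).const_mul (6 * A ^ 4 * B)).add (h2.const_mul (4 * A * B'))
    simpa using this
  refine squeeze_zero_norm' ?_ hlim
  filter_upwards [eventually_ge_atTop 1] with k hk
  refine (norm_termDeriv_le' g hk hφ hφ' z).trans (le_of_eq ?_)
  rw [← hJdef, ← hA]
  have hpow : J ^ (k - 1) = J⁻¹ * J ^ k := by
    obtain ⟨m, rfl⟩ := Nat.exists_eq_add_of_le hk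
    rw [Nat.add_sub_cancel_left, pow_add, pow_one, inv_mul_cancel_left₀ hJpos.ne']
  rw [hpow]
  ring

/-- **The value of the Poincaré series at `z₀` tends to `φ(z₀)` as `k → ∞`** when `φ` vanishes at the
exceptional orbit points `ρ γ z₀` (`γ ≠ 1`, `|J(ρ γ, z₀)| ≥ 1/2`): the identity term is `φ(z₀)`,
the exceptional terms vanish and the others are `O(|J|ᵏ)` — Tannery's theorem with the majorant
`B |J(ρ γ, z₀)|²`. [cite: Shafarevich1994, Ch. IX §3.2, Lemma (B)] -/
theorem tendsto_poincareSeries_apply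
    (z₀ : Ball) (h2 : Summable fun γ : G ↦ ‖canonicalFactor (ρ γ) z₀‖ ^ 2)
    {φ : Ball → ℂ} {B : ℝ} (hφ : ∀ z, ‖φ z‖ ≤ B)
    (hvan : ∀ γ : G, γ ≠ 1 → 1 / 2 ≤ ‖canonicalFactor (ρ γ) z₀‖ → φ (ρ γ • z₀) = 0) :
    Tendsto (fun k : ℕ ↦ ∑' γ : G, canonicalFactor (ρ γ) z₀ ^ k * φ (ρ γ • z₀)) atTop
      (𝓝 (φ z₀)) := by
  classical
  have hB : 0 ≤ B := (norm_nonneg _).trans (hφ z₀)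
  set g : G → ℂ := fun γ ↦ if γ = 1 then φ z₀ else 0 with hg
  have hlim : ∑' γ : G, g γ = φ z₀ := by
    rw [hg]
    exact tsum_ite_eq 1 (fun _ ↦ φ z₀)
  rw [← hlim]
  refine tendsto_tsum_of_dominated_convergence (h2.mul_left B) (fun γ ↦ ?_) ?_
  · -- termwise limits
    by_cases hγ : γ = 1
    · subst hγ
      simp only [hg, if_true, map_one, canonicalFactor_one, one_pow, one_mul, one_smul]
      exact tendsto_const_nhds
    · simp only [hg, if_neg hγ]
      by_cases hJ : 1 / 2 ≤ ‖canonicalFactor (ρ γ) z₀‖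
      · simp only [hvan γ hγ hJ, mul_zero]
        exact tendsto_const_nhds
      · have hJ1 : ‖canonicalFactor (ρ γ) z₀‖ < 1 := by linarith [not_le.1 hJ]
        rw [show (0 : ℂ) = 0 * φ (ρ γ • z₀) from (zero_mul _).symm]
        exact (tendsto_pow_atTop_nhds_zero_of_norm_lt_one hJ1).mul_const _
  · -- domination for `k ≥ 2`
    filter_upwards [eventually_ge_atTop 2] with k hk γ
    rw [norm_mul, norm_pow]
    by_cases hγ : γ = 1
    · subst hγ
      simp only [map_one, canonicalFactor_one, norm_one, one_pow, one_mul, mul_one, one_smul]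
      exact hφ _
    · by_cases hJ : 1 / 2 ≤ ‖canonicalFactor (ρ γ) z₀‖
      · rw [hvan γ hγ hJ, norm_zero, mul_zero]; positivity
      · have hJ1 : ‖canonicalFactor (ρ γ) z₀‖ ≤ 1 := by linarith [not_le.1 hJ]
        rw [mul_comm B]
        exact mul_le_mul (pow_le_pow_of_le_one (norm_nonneg _) hJ1 hk) (hφ _) (norm_nonneg _)
          (by positivity)

/-- `D(1)(z) = id` as a continuous linear map of `ℂ²`. [folklore] -/
private theorem JacCLM_one (z : Ball) :
    LinearMap.toContinuousLinearMap (Matrix.mulVecLin (Jac 1 z)) = ContinuousLinearMap.id ℂ _ := by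
  ext v i
  simp [Jac_one]

/-- **The derivative of the Poincaré series at `z₀` tends to `Dφ̃(z₀)` as `k → ∞`** when `φ` vanishes
to second order at the exceptional orbit points (`γ ≠ 1`, `|J(ρ γ, z₀)| ≥ 1/2`): the identity term
is `Dφ̃(z₀)` (`J̃(1, ·) = 1`), the exceptional terms vanish, the others are `O(k |J|^{k-1})` —
Tannery's theorem with the majorant `C |J(ρ γ, z₀)|²`. [cite: Shafarevich1994, Ch. IX §3.2, Lemma (B)] -/
theorem tendsto_poincareSeriesDeriv
    (z₀ : Ball) (h2 : Summable fun γ : G ↦ ‖canonicalFactor (ρ γ) z₀‖ ^ 2)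
    {φ : Ball → ℂ} {B B' : ℝ} (hφ : ∀ z, ‖φ z‖ ≤ B)
    (hφ' : ∀ z : Ball, ‖fderiv ℂ (extend ℂ φ) z.1‖ ≤ B')
    (hvan : ∀ γ : G, γ ≠ 1 → 1 / 2 ≤ ‖canonicalFactor (ρ γ) z₀‖ →
      φ (ρ γ • z₀) = 0 ∧ fderiv ℂ (extend ℂ φ) (ρ γ • z₀).1 = 0) :
    Tendsto (fun k : ℕ ↦ ∑' γ : G,
        (((k : ℂ) * canonicalFactor (ρ γ) z₀ ^ (k - 1) * φ (ρ γ • z₀)) •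
            ((-3 * (mat (ρ γ)).det / W3 (ρ γ) z₀ 2 ^ 4) • rowCLM (ρ γ) 2) +
          canonicalFactor (ρ γ) z₀ ^ k •
            ((fderiv ℂ (extend ℂ φ) (ρ γ • z₀).1).comp
              (LinearMap.toContinuousLinearMap (Matrix.mulVecLin (Jac (ρ γ) z₀))))))
      atTop (𝓝 (fderiv ℂ (extend ℂ φ) z₀.1)) := by
  classical
  have hB : 0 ≤ B := (norm_nonneg _).trans (hφ z₀)
  have hB' : 0 ≤ B' := (norm_nonneg _).trans (hφ' z₀)
  set A : ℝ := (1 - Real.sqrt (nsq z₀.1))⁻¹ with hA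
  have hA0 : 0 < A := inv_pos.2 (one_sub_sqrt_nsq_pos z₀)
  set C : ℝ := 18 * A ^ 4 * B + 4 * A * B' + B' with hC
  set g : G → ((Fin 2 → ℂ) →L[ℂ] ℂ) := fun γ ↦
    if γ = 1 then fderiv ℂ (extend ℂ φ) z₀.1 else 0 with hg
  have hlim : ∑' γ : G, g γ = fderiv ℂ (extend ℂ φ) z₀.1 := by
    rw [hg]
    exact tsum_ite_eq 1 (fun _ ↦ fderiv ℂ (extend ℂ φ) z₀.1)
  rw [← hlim]
  -- the identity term
  have hone : ∀ k : ℕ, (((k : ℂ) * canonicalFactor (ρ 1) z₀ ^ (k - 1) * φ (ρ 1 • z₀)) •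
      ((-3 * (mat (ρ 1)).det / W3 (ρ 1) z₀ 2 ^ 4) • rowCLM (ρ 1) 2) +
      canonicalFactor (ρ 1) z₀ ^ k • ((fderiv ℂ (extend ℂ φ) (ρ 1 • z₀).1).comp
        (LinearMap.toContinuousLinearMap (Matrix.mulVecLin (Jac (ρ 1) z₀))))) =
      fderiv ℂ (extend ℂ φ) z₀.1 := fun k ↦ by
    ext v
    simp [map_one, one_smul, rowCLM_one_two, canonicalFactor_one, one_pow, JacCLM_one]
  -- the exceptional terms
  have hexc : ∀ k : ℕ, ∀ γ : G, γ ≠ 1 → 1 / 2 ≤ ‖canonicalFactor (ρ γ) z₀‖ →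
      (((k : ℂ) * canonicalFactor (ρ γ) z₀ ^ (k - 1) * φ (ρ γ • z₀)) •
        ((-3 * (mat (ρ γ)).det / W3 (ρ γ) z₀ 2 ^ 4) • rowCLM (ρ γ) 2) +
      canonicalFactor (ρ γ) z₀ ^ k • ((fderiv ℂ (extend ℂ φ) (ρ γ • z₀).1).comp
        (LinearMap.toContinuousLinearMap (Matrix.mulVecLin (Jac (ρ γ) z₀))))) = 0 := by
    intro k γ hγ hJ
    obtain ⟨h0, h0'⟩ := hvan γ hγ hJ
    ext v
    simp [h0, h0']
  refine tendsto_tsum_of_dominated_convergence (h2.mul_left C) (fun γ ↦ ?_) ?_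
  · -- termwise limits
    by_cases hγ : γ = 1
    · subst hγ
      simp only [hg, if_true, hone]
      exact tendsto_const_nhds
    · simp only [hg, if_neg hγ]
      by_cases hJ : 1 / 2 ≤ ‖canonicalFactor (ρ γ) z₀‖
      · simp only [hexc _ γ hγ hJ]
        exact tendsto_const_nhds
      · have hJ1 : ‖canonicalFactor (ρ γ) z₀‖ < 1 := by linarith [not_le.1 hJ]
        exact tendsto_termDeriv_of_norm_lt_one (ρ γ) hφ hφ' z₀ hJ1
  · -- domination for `k ≥ 3`
    filter_upwards [eventually_ge_atTop 3] with k hk γ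
    by_cases hγ : γ = 1
    · subst hγ
      rw [hone k, map_one, canonicalFactor_one, norm_one, one_pow, mul_one]
      refine (hφ' z₀).trans ?_
      rw [hC]
      nlinarith [pow_pos hA0 4]
    · by_cases hJ : 1 / 2 ≤ ‖canonicalFactor (ρ γ) z₀‖
      · rw [hexc k γ hγ hJ, norm_zero]; positivity
      · refine (norm_termDeriv_le_sq (ρ γ) hk hφ hφ' z₀ (not_le.1 hJ).le).trans ?_
        rw [← hA]
        gcongr
        rw [hC]
        linarith

end Limit

/-! ### §6 Test functions: polynomials with prescribed one-jets -/

section TestFunctions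

/-- Points of the ball lie in the closed unit sup-norm ball of `ℂ²`. [folklore] -/
private theorem norm_coe_le_one (z : Ball) : ‖z.1‖ ≤ 1 := by
  rw [pi_norm_le_iff_of_nonneg zero_le_one]
  intro i
  have h : ‖z.1 i‖ ^ 2 ≤ nsq z.1 := by
    rw [nsq]
    fin_cases i
    · simp only [Fin.zero_eta, Fin.isValue, le_add_iff_nonneg_right]; positivity
    · simp only [Fin.mk_one, Fin.isValue, le_add_iff_nonneg_left]; positivity
  nlinarith [z.2, norm_nonneg (z.1 i)]

/-- **Restriction of a `C¹` function on `ℂ²` to the ball**: it is holomorphic in the sense of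
`BallForms.holomorphic`, bounded, its zero extension has the derivative of the original function at the
points of the ball, and that derivative is bounded on the ball (continuity on the closed unit polydisc).
[folklore] -/
private theorem restrict_mem_holomorphic {p : (Fin 2 → ℂ) → ℂ} (hp : ContDiff ℂ 1 p) :
    (fun z : Ball ↦ p z.1) ∈ holomorphic ℂ ∧
    (∃ B : ℝ, ∀ z : Ball, ‖p z.1‖ ≤ B) ∧
    (∀ z : Ball, fderiv ℂ (extend ℂ fun z : Ball ↦ p z.1) z.1 = fderiv ℂ p z.1) ∧
    (∃ B' : ℝ, ∀ z : Ball, ‖fderiv ℂ (extend ℂ fun z : Ball ↦ p z.1) z.1‖ ≤ B') := by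
  have heq : ∀ z : Ball, (extend ℂ fun z : Ball ↦ p z.1) =ᶠ[𝓝 z.1] p := fun z ↦ by
    filter_upwards [isOpen_ballSet.mem_nhds (coe_mem_ballSet z)] with y hy
    exact extend_apply_coe (fun z : Ball ↦ p z.1) ⟨y, hy⟩
  have hfd : ∀ z : Ball, fderiv ℂ (extend ℂ fun z : Ball ↦ p z.1) z.1 = fderiv ℂ p z.1 :=
    fun z ↦ (heq z).fderiv_eq
  have hK : IsCompact (Metric.closedBall (0 : Fin 2 → ℂ) 1) := isCompact_closedBall _ _
  have hmem : ∀ z : Ball, z.1 ∈ Metric.closedBall (0 : Fin 2 → ℂ) 1 := fun z ↦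
    mem_closedBall_zero_iff.2 (norm_coe_le_one z)
  refine ⟨?_, ?_, hfd, ?_⟩
  · rw [mem_holomorphic_iff]
    exact (hp.differentiable one_ne_zero).differentiableOn.congr fun y hy ↦
      extend_apply_coe (fun z : Ball ↦ p z.1) ⟨y, hy⟩
  · obtain ⟨B, hB⟩ := hK.exists_bound_of_continuousOn hp.continuous.continuousOn
    exact ⟨B, fun z ↦ hB _ (hmem z)⟩
  · obtain ⟨B', hB'⟩ := hK.exists_bound_of_continuousOn (hp.continuous_fderiv one_ne_zero).continuousOn
    exact ⟨B', fun z ↦ by rw [hfd]; exact hB' _ (hmem z)⟩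

/-- **A polynomial with prescribed zeros of order two**: for `z₀ ∈ 𝔹²` and a finite set `Q ⊆ 𝔹²` of
points different from `z₀` there is a `C¹` (indeed polynomial) function `P` on `ℂ²` with `P(z₀) = 1`
vanishing together with its derivative at every point of `Q` (a product of squares of affine forms;
Shafarevich: "these can be found for example among polynomials").
[cite: Shafarevich1994, Ch. IX §3.2, Lemma (B)] -/
theorem exists_poly_eq_one_vanishing (z₀ : Ball) (Q : Finset Ball) (hQ : z₀ ∉ Q) :
    ∃ P : (Fin 2 → ℂ) → ℂ, ContDiff ℂ 1 P ∧ P z₀.1 = 1 ∧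
      ∀ q ∈ Q, P q.1 = 0 ∧ HasFDerivAt P (0 : (Fin 2 → ℂ) →L[ℂ] ℂ) q.1 := by
  classical
  -- the normalising constants `c q = |z₀ - q|² ≠ 0`
  set c : Ball → ℂ := fun q ↦ ∑ i, starRingEnd ℂ (z₀.1 i - q.1 i) * (z₀.1 i - q.1 i) with hc
  have hc_ne : ∀ q ∈ Q, c q ≠ 0 := by
    intro q hq hzero
    have hne : q ≠ z₀ := fun h ↦ hQ (h ▸ hq)
    have hcq : c q = ((‖z₀.1 0 - q.1 0‖ ^ 2 + ‖z₀.1 1 - q.1 1‖ ^ 2 : ℝ) : ℂ) := by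
      simp only [hc, Fin.sum_univ_two, Complex.conj_mul']
      push_cast
      ring
    rw [hcq, Complex.ofReal_eq_zero] at hzero
    have h0 : ‖z₀.1 0 - q.1 0‖ = 0 := by nlinarith [norm_nonneg (z₀.1 0 - q.1 0), norm_nonneg (z₀.1 1 - q.1 1)]
    have h1 : ‖z₀.1 1 - q.1 1‖ = 0 := by nlinarith [norm_nonneg (z₀.1 0 - q.1 0), norm_nonneg (z₀.1 1 - q.1 1)]
    rw [norm_eq_zero, sub_eq_zero] at h0 h1
    exact hne (Ball.ext fun i ↦ by fin_cases i <;> simp [h0, h1])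
  -- the affine forms `a q` with `a q z₀ = 1`, `a q q = 0`
  set a : Ball → (Fin 2 → ℂ) → ℂ := fun q y ↦
    (∑ i, starRingEnd ℂ (z₀.1 i - q.1 i) * (y i - q.1 i)) / c q with ha
  have ha_z₀ : ∀ q ∈ Q, a q z₀.1 = 1 := fun q hq ↦ by
    simp only [ha]
    exact div_self (hc_ne q hq)
  have ha_q : ∀ q : Ball, a q q.1 = 0 := fun q ↦ by
    simp [ha]
  have ha_diff : ∀ q : Ball, ContDiff ℂ 1 (a q) := fun q ↦ by
    simp only [ha]
    exact (ContDiff.sum fun i _ ↦ contDiff_const.mul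
      ((contDiff_apply ℂ ℂ i).sub contDiff_const)).div_const _
  -- the product of squares
  refine ⟨fun y ↦ ∏ q ∈ Q, a q y ^ 2, contDiff_prod fun q _ ↦ (ha_diff q).pow 2, ?_, fun q hq ↦ ⟨?_, ?_⟩⟩
  · exact Finset.prod_eq_one fun q hq ↦ by rw [ha_z₀ q hq, one_pow]
  · exact Finset.prod_eq_zero hq (by rw [ha_q q]; ring)
  · -- `P = a q · (a q · R)` with both factors vanishing at `q`
    have hsplit : (fun y ↦ ∏ q' ∈ Q, a q' y ^ 2) =
        fun y ↦ a q y * (a q y * ∏ q' ∈ Q.erase q, a q' y ^ 2) := by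
      funext y
      rw [← Finset.mul_prod_erase Q (fun q' ↦ a q' y ^ 2) hq, pow_two, mul_assoc]
    rw [hsplit]
    have h1 : HasFDerivAt (a q) (fderiv ℂ (a q) q.1) q.1 :=
      ((ha_diff q).differentiable one_ne_zero _).hasFDerivAt
    have hR : ContDiff ℂ 1 fun y ↦ a q y * ∏ q' ∈ Q.erase q, a q' y ^ 2 :=
      (ha_diff q).mul (contDiff_prod fun q' _ ↦ (ha_diff q').pow 2)
    have h2 : HasFDerivAt (fun y ↦ a q y * ∏ q' ∈ Q.erase q, a q' y ^ 2)
        (fderiv ℂ (fun y ↦ a q y * ∏ q' ∈ Q.erase q, a q' y ^ 2) q.1) q.1 :=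
      (hR.differentiable one_ne_zero _).hasFDerivAt
    refine (h1.mul h2).congr_fderiv ?_
    ext v
    simp [ha_q q]

/-- **Test functions at a point**: for `z₀ ∈ 𝔹²` and a finite set `Q` of points of the ball different
from `z₀` there are holomorphic, bounded functions `φ₀, φ₁, φ₂` on the ball with bounded derivative,
vanishing to second order on `Q`, with `φ₀(z₀) = 1`, `φⱼ(z₀) = 0` and `Dφ̃ⱼ(z₀) = dz_{j-1}` (`j = 1, 2`)
— restrictions of polynomials. [cite: Shafarevich1994, Ch. IX §3.2, Lemma (B)] -/
theorem exists_testFunctions (z₀ : Ball) (Q : Finset Ball) (hQ : z₀ ∉ Q) :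
    ∃ φ : Fin 3 → (Ball → ℂ),
      (∀ i, φ i ∈ holomorphic ℂ) ∧
      (∀ i, ∃ B : ℝ, ∀ z, ‖φ i z‖ ≤ B) ∧
      (∀ i, ∃ B' : ℝ, ∀ z : Ball, ‖fderiv ℂ (extend ℂ (φ i)) z.1‖ ≤ B') ∧
      (∀ i, ∀ q ∈ Q, φ i q = 0 ∧ fderiv ℂ (extend ℂ (φ i)) q.1 = 0) ∧
      φ 0 z₀ = 1 ∧ φ 1 z₀ = 0 ∧ φ 2 z₀ = 0 ∧
      fderiv ℂ (extend ℂ (φ 1)) z₀.1 = ContinuousLinearMap.proj 0 ∧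
      fderiv ℂ (extend ℂ (φ 2)) z₀.1 = ContinuousLinearMap.proj 1 := by
  obtain ⟨P, hP, hP1, hPQ⟩ := exists_poly_eq_one_vanishing z₀ Q hQ
  -- the multipliers `1, y₀ - z₀₀, y₁ - z₀₁` and their derivatives
  set m : Fin 3 → (Fin 2 → ℂ) → ℂ :=
    ![fun _ ↦ 1, fun y ↦ y 0 - z₀.1 0, fun y ↦ y 1 - z₀.1 1] with hm
  set m' : Fin 3 → ((Fin 2 → ℂ) →L[ℂ] ℂ) :=
    ![0, ContinuousLinearMap.proj 0, ContinuousLinearMap.proj 1] with hm'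
  have hmd : ∀ i (y : Fin 2 → ℂ), HasFDerivAt (m i) (m' i) y := by
    intro i y
    fin_cases i
    · exact hasFDerivAt_const _ _
    · exact (hasFDerivAt_apply 0 y).sub_const _
    · exact (hasFDerivAt_apply 1 y).sub_const _
  have hmc : ∀ i, ContDiff ℂ 1 (m i) := by
    intro i
    fin_cases i
    · exact contDiff_const
    · exact (contDiff_apply ℂ ℂ 0).sub contDiff_const
    · exact (contDiff_apply ℂ ℂ 1).sub contDiff_const
  set p : Fin 3 → (Fin 2 → ℂ) → ℂ := fun i y ↦ m i y * P y with hp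
  have hpc : ∀ i, ContDiff ℂ 1 (p i) := fun i ↦ (hmc i).mul hP
  have hPd : ∀ y, HasFDerivAt P (fderiv ℂ P y) y := fun y ↦ (hP.differentiable one_ne_zero _).hasFDerivAt
  -- the test functions
  refine ⟨fun i z ↦ p i z.1, fun i ↦ (restrict_mem_holomorphic (hpc i)).1,
    fun i ↦ (restrict_mem_holomorphic (hpc i)).2.1, fun i ↦ (restrict_mem_holomorphic (hpc i)).2.2.2,
    fun i q hq ↦ ⟨?_, ?_⟩, ?_, ?_, ?_, ?_, ?_⟩
  · -- vanishing on `Q`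
    change m i q.1 * P q.1 = 0
    rw [(hPQ q hq).1, mul_zero]
  · rw [(restrict_mem_holomorphic (hpc i)).2.2.1 q]
    refine ((hmd i q.1).mul (hPQ q hq).2).fderiv.trans ?_
    ext v
    simp [(hPQ q hq).1]
  · change m 0 z₀.1 * P z₀.1 = 1
    simp [hm, hP1]
  · change m 1 z₀.1 * P z₀.1 = 0
    simp [hm]
  · change m 2 z₀.1 * P z₀.1 = 0
    simp [hm]
  · rw [(restrict_mem_holomorphic (hpc 1)).2.2.1 z₀]
    refine ((hmd 1 z₀.1).mul (hPd z₀.1)).fderiv.trans ?_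
    ext v
    simp [hm, hm', hP1]
  · rw [(restrict_mem_holomorphic (hpc 2)).2.2.1 z₀]
    refine ((hmd 2 z₀.1).mul (hPd z₀.1)).fderiv.trans ?_
    ext v
    simp [hm, hm', hP1]

end TestFunctions

/-! ### §7 Poincaré series immerse the ball at every point -/

section Immersion

variable {G : Type*} [Group G] (ρ : G →* U21)

/-- The **exceptional set** at `z₀` is finite: only finitely many `γ` have `|J(ρ γ, z₀)| ≥ 1/2`
(the lattice sum `∑_γ |J(ρ γ, z₀)|²` converges). [cite: Shafarevich1994, Ch. IX §3.2, Lemma (B)] -/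
theorem finite_setOf_half_le_norm_canonicalFactor (z₀ : Ball)
    (h2 : Summable fun γ : G ↦ ‖canonicalFactor (ρ γ) z₀‖ ^ 2) :
    {γ : G | 1 / 2 ≤ ‖canonicalFactor (ρ γ) z₀‖}.Finite := by
  have h := h2.tendsto_cofinite_zero.eventually (gt_mem_nhds (show (0 : ℝ) < 1 / 4 by norm_num))
  rw [Filter.eventually_cofinite] at h
  refine h.subset fun γ hγ ↦ ?_
  simp only [Set.mem_setOf_eq, not_lt] at hγ ⊢
  nlinarith [hγ, norm_nonneg (canonicalFactor (ρ γ) z₀)]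

/-- **Poincaré series separate tangent vectors** (Shafarevich's Lemma B on the ball `𝔹²`): let
`ρ : Γ → U(2,1)` have discrete image (`∑_γ ‖(ρ γ)₂₂‖⁻ⁿ < ∞` for `n ≥ 6`, whence the Poincaré series
converge) and act freely at `z₀`. Then there are three bounded holomorphic test functions `φ₀, φ₁, φ₂`
on the ball (restrictions of polynomials, with bounded derivative) such that for all large weights `k`
the Poincaré series `fᵢ = ∑_γ J(ρ γ, ·)ᵏ φᵢ(ρ γ ·)` satisfy: `f₀(z₀) ≠ 0`, each `f̃ᵢ` is differentiable
at `z₀` with derivative `Lᵢ` (the termwise differentiated series), and the `3 × 3` matrix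
`(fᵢ(z₀), Lᵢ e₀, Lᵢ e₁)ᵢ` is invertible — i.e. `z ↦ (f₁/f₀, f₂/f₀)` is a local biholomorphism at
`z₀`, equivalently `[f₀ : f₁ : f₂]` is an immersion at `z₀`. (As `k → ∞` the matrix tends to
`(φᵢ(z₀), ∂₀φᵢ(z₀), ∂₁φᵢ(z₀))ᵢ`, which is unipotent for the chosen one-jets.)
[cite: Shafarevich1994, Ch. IX §3.2, Lemma (B)] -/
theorem exists_poincareSeries_immersion
    (hS : ∀ n : ℕ, 6 ≤ n → Summable fun γ : G ↦ (‖mat (ρ γ) 2 2‖ ^ n)⁻¹)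
    (z₀ : Ball) (hfree : ∀ γ : G, ρ γ • z₀ = z₀ → γ = 1) :
    ∃ φ : Fin 3 → (Ball → ℂ),
      (∀ i, φ i ∈ holomorphic ℂ) ∧
      (∀ i, ∃ B : ℝ, ∀ z, ‖φ i z‖ ≤ B) ∧
      (∀ i, ∃ B' : ℝ, ∀ z : Ball, ‖fderiv ℂ (extend ℂ (φ i)) z.1‖ ≤ B') ∧
      ∃ k₀ : ℕ, ∀ k ≥ k₀, ∃ L : Fin 3 → ((Fin 2 → ℂ) →L[ℂ] ℂ),
        (∀ i, HasFDerivAt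
          (extend ℂ fun z ↦ ∑' γ : G, canonicalFactor (ρ γ) z ^ k * φ i (ρ γ • z)) (L i) z₀.1) ∧
        (∑' γ : G, canonicalFactor (ρ γ) z₀ ^ k * φ 0 (ρ γ • z₀)) ≠ 0 ∧
        (Matrix.of fun i : Fin 3 ↦
          ![∑' γ : G, canonicalFactor (ρ γ) z₀ ^ k * φ i (ρ γ • z₀),
            L i (Pi.single 0 1), L i (Pi.single 1 1)]).det ≠ 0 := by
  classical
  have h2 := summable_sq_norm_canonicalFactor ρ hS z₀
  -- the exceptional orbit points
  have hE := finite_setOf_half_le_norm_canonicalFactor ρ z₀ h2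
  set Q : Finset Ball := (hE.toFinset.erase 1).image fun γ ↦ ρ γ • z₀ with hQ
  have hz₀Q : z₀ ∉ Q := by
    intro h
    obtain ⟨γ, hγ, hγz⟩ := Finset.mem_image.1 h
    exact (Finset.mem_erase.1 hγ).1 (hfree γ hγz)
  have hmemQ : ∀ γ : G, γ ≠ 1 → 1 / 2 ≤ ‖canonicalFactor (ρ γ) z₀‖ → ρ γ • z₀ ∈ Q :=
    fun γ hγ hJ ↦ Finset.mem_image.2 ⟨γ, Finset.mem_erase.2 ⟨hγ, hE.mem_toFinset.2 hJ⟩, rfl⟩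
  -- the test functions
  obtain ⟨φ, hφh, hφB, hφB', hφQ, hφ0, hφ1, hφ2, hd1, hd2⟩ := exists_testFunctions z₀ Q hz₀Q
  choose B hB using hφB
  choose B' hB' using hφB'
  have hvan : ∀ i, ∀ γ : G, γ ≠ 1 → 1 / 2 ≤ ‖canonicalFactor (ρ γ) z₀‖ →
      φ i (ρ γ • z₀) = 0 ∧ fderiv ℂ (extend ℂ (φ i)) (ρ γ • z₀).1 = 0 :=
    fun i γ hγ hJ ↦ hφQ i _ (hmemQ γ hγ hJ)
  refine ⟨φ, hφh, fun i ↦ ⟨B i, hB i⟩, fun i ↦ ⟨B' i, hB' i⟩, ?_⟩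
  -- the values and derivatives of the Poincaré series at `z₀`, as functions of the weight
  set A : Fin 3 → ℕ → ℂ := fun i k ↦ ∑' γ : G, canonicalFactor (ρ γ) z₀ ^ k * φ i (ρ γ • z₀) with hA
  set LD : Fin 3 → ℕ → ((Fin 2 → ℂ) →L[ℂ] ℂ) := fun i k ↦ ∑' γ : G,
    ((((k : ℂ) * canonicalFactor (ρ γ) z₀ ^ (k - 1) * φ i (ρ γ • z₀)) •
        ((-3 * (mat (ρ γ)).det / W3 (ρ γ) z₀ 2 ^ 4) • rowCLM (ρ γ) 2) +
      canonicalFactor (ρ γ) z₀ ^ k •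
        ((fderiv ℂ (extend ℂ (φ i)) (ρ γ • z₀).1).comp
          (LinearMap.toContinuousLinearMap (Matrix.mulVecLin (Jac (ρ γ) z₀)))))) with hLD
  have hA_lim : ∀ i, Tendsto (A i) atTop (𝓝 (φ i z₀)) := fun i ↦
    tendsto_poincareSeries_apply ρ z₀ h2 (hB i) fun γ hγ hJ ↦ (hvan i γ hγ hJ).1
  have hLD_lim : ∀ i, Tendsto (LD i) atTop (𝓝 (fderiv ℂ (extend ℂ (φ i)) z₀.1)) := fun i ↦
    tendsto_poincareSeriesDeriv ρ z₀ h2 (hB i) (hB' i) (hvan i)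
  -- the matrix of one-jets and its limit
  set M : ℕ → Matrix (Fin 3) (Fin 3) ℂ := fun k ↦
    Matrix.of fun i ↦ ![A i k, LD i k (Pi.single 0 1), LD i k (Pi.single 1 1)] with hM
  set Minf : Matrix (Fin 3) (Fin 3) ℂ := Matrix.of fun i ↦
    ![φ i z₀, fderiv ℂ (extend ℂ (φ i)) z₀.1 (Pi.single 0 1),
      fderiv ℂ (extend ℂ (φ i)) z₀.1 (Pi.single 1 1)] with hMinf
  have hMinf_det : Minf.det = 1 := by
    rw [Matrix.det_fin_three]
    simp [hMinf, hφ0, hφ1, hφ2, hd1, hd2]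
  have hM_lim : Tendsto M atTop (𝓝 Minf) := by
    refine tendsto_pi_nhds.2 fun i ↦ tendsto_pi_nhds.2 fun j ↦ ?_
    have hev : ∀ v : Fin 2 → ℂ, Tendsto (fun k ↦ LD i k v) atTop
        (𝓝 (fderiv ℂ (extend ℂ (φ i)) z₀.1 v)) := fun v ↦
      ((ContinuousLinearMap.apply ℂ ℂ v).continuous.tendsto _).comp (hLD_lim i)
    fin_cases j
    · simpa [hM, hMinf] using hA_lim i
    · simpa [hM, hMinf] using hev (Pi.single 0 1)
    · simpa [hM, hMinf] using hev (Pi.single 1 1)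
  have hdet_lim : Tendsto (fun k ↦ (M k).det) atTop (𝓝 1) := by
    rw [← hMinf_det]
    exact ((continuous_id.matrix_det).tendsto Minf).comp hM_lim
  -- for large `k` the determinant and `f₀(z₀)` do not vanish
  have hev := ((hdet_lim.eventually_ne one_ne_zero).and
    (((hA_lim 0).eventually_ne (by rw [hφ0]; exact one_ne_zero)).and (eventually_ge_atTop 2)))
  obtain ⟨k₀, hk₀⟩ := Filter.eventually_atTop.1 hev
  refine ⟨k₀, fun k hk ↦ ⟨fun i ↦ LD i k, fun i ↦ ?_, (hk₀ k hk).2.1, (hk₀ k hk).1⟩⟩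
  exact hasFDerivAt_extend_poincareSeries ρ hS (hk₀ k hk).2.2 (hφh i) (hB i) (hB' i) z₀

end Immersion

/-! ### §8 Subgroups of `U(2,1)` acting freely -/

section Subgroup

variable (Δ : Subgroup U21)

/-- Freeness of a subgroup action in the form used above: `γ • z₀ = z₀ → γ = 1`. [folklore] -/
private theorem eq_one_of_smul_eq [IsCancelSMul Δ Ball] (z₀ : Ball) (γ : Δ) (h : Δ.subtype γ • z₀ = z₀) :
    γ = 1 :=
  IsCancelSMul.right_cancel γ 1 z₀ (by rw [one_smul]; exact h)

/-- **Poincaré series separate tangent vectors — subgroup form**: for `Δ ≤ U(2,1)` acting freely on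
`𝔹²` with convergent lattice sums `∑_{γ ∈ Δ} ‖γ₂₂‖⁻ⁿ` (`n ≥ 6`; by `UnitaryBallPoincareSeries` this holds
as soon as `{γ ∈ Δ | ‖γ₂₂‖ ≤ R}` is finite for every `R`, e.g. for properly discontinuous `Δ`) and every
`z₀ ∈ 𝔹²`, three Poincaré series of a common large weight have invertible one-jet matrix at `z₀`.
[cite: Shafarevich1994, Ch. IX §3.2, Lemma (B)] -/
theorem exists_poincareSeries_immersion_subgroup [IsCancelSMul Δ Ball]
    (hS : ∀ n : ℕ, 6 ≤ n → Summable fun γ : Δ ↦ (‖mat (γ : U21) 2 2‖ ^ n)⁻¹) (z₀ : Ball) :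
    ∃ φ : Fin 3 → (Ball → ℂ),
      (∀ i, φ i ∈ holomorphic ℂ) ∧
      (∀ i, ∃ B : ℝ, ∀ z, ‖φ i z‖ ≤ B) ∧
      (∀ i, ∃ B' : ℝ, ∀ z : Ball, ‖fderiv ℂ (extend ℂ (φ i)) z.1‖ ≤ B') ∧
      ∃ k₀ : ℕ, ∀ k ≥ k₀, ∃ L : Fin 3 → ((Fin 2 → ℂ) →L[ℂ] ℂ),
        (∀ i, HasFDerivAt
          (extend ℂ fun z ↦ ∑' γ : Δ, canonicalFactor (γ : U21) z ^ k * φ i ((γ : U21) • z))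
            (L i) z₀.1) ∧
        (∑' γ : Δ, canonicalFactor (γ : U21) z₀ ^ k * φ 0 ((γ : U21) • z₀)) ≠ 0 ∧
        (Matrix.of fun i : Fin 3 ↦
          ![∑' γ : Δ, canonicalFactor (γ : U21) z₀ ^ k * φ i ((γ : U21) • z₀),
            L i (Pi.single 0 1), L i (Pi.single 1 1)]).det ≠ 0 :=
  exists_poincareSeries_immersion Δ.subtype hS z₀ (eq_one_of_smul_eq Δ z₀)

end Subgroup
end BallPoincare

end Literature.AlgebraicGeometry.ShimuraVarieties

end
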